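import Mathlib
import Summits.ValiantsHypothesis.ValiantsHypothesis.Theorems.LacunarySymmetroidMatrixDescartesStubArith

/-!
# Crux `MatrixDescartes` (stmt-ValiantsHypothesis-18050), line `Lift` — registered stub `stub_arith3`

ZERO-COUNT arithmetic of the transfer from the TWO lifted pencils (`2K` terms each, parameters
`(c + 2, 4q)`) back to the original pencil (`K` terms, parameters `(c, q)`): the real-root count
`Z` of the original pencil satisfies `Z ≤ A + B + 1`, where `A`, `B` are the positive-root counts
of the lifts of `F(X)`, `F(-X)`; if `A^{4q}, B^{4q} ≤ 2^{2K ⌊log₂ 2K⌋}` then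
`Z^q ≤ 2^{K ⌊log₂ K⌋}` whenever `K ≥ 4` and `4q ≤ K`.

Proof. Put `L = ⌊log₂ K⌋`; then `⌊log₂ 2K⌋ = L + 1` and `L ≥ 2`
(`StubArith.log_two_add_self`, `StubArith.two_le_log_two` of the sibling stub file).
With `M = max (max A B) 1` we have `Z ≤ 3M` and `M^{4q} ≤ 2^{2K(L+1)}`, hence
`(Z^q)^4 = Z^{4q} ≤ 3^{4q} M^{4q} ≤ 2^{7q} · 2^{2K(L+1)} ≤ 2^{4KL} = (2^{KL})^4`
(as `81 ≤ 2^7` and `7q + 2K(L+1) ≤ 4KL` from `8q ≤ 2K`, `4K ≤ 2KL`), and fourth powers are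
monotone (`Nat.pow_le_pow_iff_left`). The case `q = 0` is covered by the same chain.

Elementary; Mathlib + the sibling stub file `LacunarySymmetroidMatrixDescartesStubArith`
(axioms `propext`, `Classical.choice`, `Quot.sound`).
-/

-- layout Summits/ValiantsHypothesis/ValiantsHypothesis forces the duplicated namespace component
set_option linter.dupNamespace false

namespace Summit.ValiantsHypothesis.ValiantsHypothesis.Theorems.LacunarySymmetroidMatrixDescartes

/-- **Registered stub `stub_arith3`** (zero-count arithmetic of the two-lift transfer
`(c, q, K) ↦ (c + 2, 4q, 2K)`): for `K ≥ 4`, `4q ≤ K`, `Z ≤ A + B + 1` and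
`A^{4q}, B^{4q} ≤ 2^{(K + K) ⌊log₂ (K + K)⌋}` we get `Z^q ≤ 2^{K ⌊log₂ K⌋}`. -/
theorem stub_arith3 (K q A B Z : ℕ) (hK : 4 ≤ K) (hqK : 4 * q ≤ K) (hZ : Z ≤ A + B + 1)
    (hA : A ^ (4 * q) ≤ 2 ^ ((K + K) * Nat.log 2 (K + K)))
    (hB : B ^ (4 * q) ≤ 2 ^ ((K + K) * Nat.log 2 (K + K))) :
    Z ^ q ≤ 2 ^ (K * Nat.log 2 K) := by
  rw [StubArith.log_two_add_self K (by omega)] at hA hB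
  have hL2 : 2 ≤ Nat.log 2 K := StubArith.two_le_log_two hK
  -- `M := max (max A B) 1` dominates `A`, `B`, `1` and inherits the `4q`-th power bound.
  obtain ⟨M, hAM, hBM, h1M, hM⟩ : ∃ M, A ≤ M ∧ B ≤ M ∧ 1 ≤ M ∧
      M ^ (4 * q) ≤ 2 ^ ((K + K) * (Nat.log 2 K + 1)) := by
    refine ⟨max (max A B) 1, le_trans (le_max_left A B) (le_max_left (max A B) 1),
      le_trans (le_max_right A B) (le_max_left (max A B) 1), le_max_right (max A B) 1, ?_⟩
    rcases max_choice (max A B) 1 with h | h <;> rw [h]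
    · rcases max_choice A B with h' | h' <;> rw [h']
      · exact hA
      · exact hB
    · rw [one_pow]
      exact Nat.one_le_two_pow
  have hZM : Z ≤ 3 * M := by omega
  -- `3^{4q} = 81^q ≤ 128^q = 2^{7q}`.
  have h81 : (3 : ℕ) ^ (4 * q) ≤ 2 ^ (7 * q) := by
    rw [pow_mul, pow_mul]
    exact Nat.pow_le_pow_left (by norm_num) q
  -- exponent comparison `7q + 2K(L + 1) ≤ 4KL` (`8q ≤ 2K` and `4K ≤ 2KL`).
  have hexp : 7 * q + (K + K) * (Nat.log 2 K + 1) ≤ 4 * (K * Nat.log 2 K) := by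
    have h1 : K * 2 ≤ K * Nat.log 2 K := Nat.mul_le_mul_left K hL2
    have h2 : (K + K) * (Nat.log 2 K + 1) = 2 * (K * Nat.log 2 K) + 2 * K := by ring
    omega
  have h4 : (Z ^ q) ^ 4 ≤ (2 ^ (K * Nat.log 2 K)) ^ 4 :=
    calc (Z ^ q) ^ 4 = Z ^ (4 * q) := (pow_mul' Z 4 q).symm
      _ ≤ (3 * M) ^ (4 * q) := Nat.pow_le_pow_left hZM _
      _ = 3 ^ (4 * q) * M ^ (4 * q) := mul_pow 3 M (4 * q)
      _ ≤ 2 ^ (7 * q) * 2 ^ ((K + K) * (Nat.log 2 K + 1)) := Nat.mul_le_mul h81 hM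
      _ = 2 ^ (7 * q + (K + K) * (Nat.log 2 K + 1)) := (pow_add 2 _ _).symm
      _ ≤ 2 ^ (4 * (K * Nat.log 2 K)) := Nat.pow_le_pow_right (by norm_num) hexp
      _ = (2 ^ (K * Nat.log 2 K)) ^ 4 := pow_mul' 2 4 _
  exact (Nat.pow_le_pow_iff_left (by norm_num)).1 h4

end Summit.ValiantsHypothesis.ValiantsHypothesis.Theorems.LacunarySymmetroidMatrixDescartes
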